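import Literature.AlgebraicGeometry.Resolution.AlterationsFormalNodes
import Literature.AlgebraicGeometry.Resolution.AlterationsSemiStableThickness
import HarnessLib

/-!
# De Jong's alteration theorem: the trace of `Sing(f)` on the complete local ring (de Jong 1996,
# 2.23, Remark) — the split nodal structure with its singular scheme

Topic: `Literature/AlgebraicGeometry/Resolution`. Companion to `AlterationsFormalNodes.lean`,
whose named fact `DeJong1996SplitNodalStructure` renders 2.23 + 3.3 (split case) at a closed
point `x` of `Sing(f)`: `𝒪̂_{X,x} ≅ k⟦u, v, T₁, …, T_m⟧/(uv - ∏ Tᵢ^{νᵢ})`, `f^#(tᵢ) ↦ Tᵢ`. The same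
paragraph 2.23 prints one more piece of information about this presentation, which every
analysis of the singular locus of `X` in §3 uses (3.3: "The singular locus of `f` traced on
`Spec B` maps isomorphically to the closed subscheme `V(h) ⊂ Spec A'`"; 3.4: "the complete local
ring of `T` at `x` corresponds to the quotient map `B → A'/t₁A'`"; 3.5: "In the equations above
`X` is singular along `u = v = t₁ = t₂ = 0`"):

> "We remark that in this case (i.e. `h ∈ A'`) the trace of `Sing(f)` on the scheme `Spec B`
> is given by the ideal `(u, v) ⊂ B`. This lies over the closed subscheme of `Spec A` given by
> the element `N_{A'/A}(h) ∈ 𝔪_A ⊂ A`, the map being finite étale." (2.23, p. 62)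

with `Sing(f)` the closed subscheme of 2.21: "Let `Sing(f) ⊂ X` be the closed subscheme defined
by the first Fitting ideal of the sheaf `Ω_{X/S}`." This file vendors the NAMED FACT
`DeJong1996SplitNodalStructureSing`: the split nodal structure TOGETHER WITH the remark — the
isomorphism `e : 𝒪̂_{X,x} ≅ k⟦u, v, T⟧/(uv - ∏ Tᵢ^{νᵢ})` carries the extension to `𝒪̂_{X,x}` of
the stalk at `x` of `Fitt₁(Ω_{X/Y})` (`Scheme.Hom.singFittingIdeal f x`,
`AlterationsSemiStableThickness.lean`) to the ideal `(u, v)` — and PROVES that it refines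
`DeJong1996SplitNodalStructure` (`DeJong1996SplitNodalStructure.of_sing`). (The presentation of
3.3 differs from that of 2.23 by the `A`-automorphism `u ↦ εu` of `A⟦u, v⟧`, which preserves
the ideal `(u, v)`, and by Cohen's identification `A = k⟦T⟧`; Fitting ideals commute with the
base change `B → B̂`.) It is the node through which the codimension-3 analysis of 3.5 reads the
singular locus of `X` on the completion: a prime of `𝒪̂_{X,x}` containing `(u, v)` contains the
extension of `Fitt₁(Ω)_x ⊆ 𝒪_{X,x}`, an ideal of the local ring itself.

## Sources

* A. J. de Jong, *Smoothness, semi-stability and alterations*, Publ. Math. IHÉS 83 (1996) 51–93: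
  2.21, 2.23 with its Remark (pp. 61–62), 3.3–3.5 (pp. 63–64), 4.24 (p. 75).
* D. Eisenbud, *Commutative Algebra*, GTM 150 (1995), Cor. 20.5 (Fitting ideals commute with
  base change), via `AlterationsSemiStableThickness.lean`.
-/

noncomputable section

open CategoryTheory CategoryTheory.Limits AlgebraicGeometry TopologicalSpace Topology
  IsLocalRing

namespace Literature.AlgebraicGeometry.Resolution

universe u

open Scheme.IdealSheafData

/-! ## The split nodal structure with the trace of `Sing(f)` -/

/-- NAMED FACT — **de Jong 1996, 2.23 with its Remark, and 3.3 (split case): the complete local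
ring at a closed point of `Sing(f)` and the trace of `Sing(f)` on it.** 2.23: "… The complete
local ring of `X` at `x` is `B ≅ A⟦u, v⟧/(uv - h)` for some `h ∈ A`." — "We remark that in
this case (i.e. `h ∈ A'`) the trace of `Sing(f)` on the scheme `Spec B` is given by the ideal
`(u, v) ⊂ B`." (`Sing(f)` being, 2.21, "the closed subscheme defined by the first Fitting ideal
of the sheaf `Ω_{X/S}`") — 3.3: "`h = ε t₁^{n₁} ⋯ t_r^{n_r}` … We change `Q` into `ε⁻¹Q`. Thus
we have `B ≅ A'⟦u, v⟧/(Q - t₁^{n₁} ⋯ t_r^{n_r})` … in the split case we may assume `A = A'` and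
`Q(u, v) = uv`" — 4.24: "there we consider only closed points, so that the situation is
automatically split". Rendered exactly as `DeJong1996SplitNodalStructure` (the curve
`f : X → Y` of a pair in Situation 4.23 over an algebraically closed field `k`; a closed point
`x` at which `f` is not smooth; a regular system of parameters `t₁, …, t_m` of `𝒪_{Y,f x}`,
`m = dim 𝒪_{Y,f x}`, with `I(D)_{f x} = (t₁ ⋯ t_r)`; exponents `νᵢ`, zero for `i > r`, and a
ring isomorphism `e : 𝒪̂_{X,x} ≅ k⟦u, v, T₁, …, T_m⟧/(uv - ∏ Tᵢ^{νᵢ})` with `f^#(tᵢ) ↦ Tᵢ`), with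
in addition the Remark: `e` carries the extension to `𝒪̂_{X,x}` of the stalk at `x` of the
first Fitting ideal of `Ω_{X/Y}` (`Scheme.Hom.singFittingIdeal f x`, the stalk of the ideal of
the closed subscheme `Sing(f)`) onto the ideal `(u, v)`. (The change of coordinates `u ↦ εu`
of 3.3 and Cohen's identification `A = k⟦T⟧` preserve `(u, v)`; the Fitting ideal of
`Ω_{B/A} ⊗_B B̂ = Ω̂_{B̂/Â} = (B̂ du ⊕ B̂ dv)/(v du + u dv)` is `(u, v)`.) Users take
`(h : DeJong1996SplitNodalStructureSing)`; it refines `DeJong1996SplitNodalStructure`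
(`DeJong1996SplitNodalStructure.of_sing`) and is the node carrying 2.23 (formal structure of
the node and its Fitting ideal) and the first half of 3.3.
[cite: DeJong1996, 2.23 with Remark and 3.3, pp. 61–63] -/
def DeJong1996SplitNodalStructureSing : Prop :=
  ∀ (k : Type u) [Field k] [IsAlgClosed k] (X Y : Scheme.{u}) (f : X ⟶ Y)
    (g : Y ⟶ Spec (.of k)) (D : Set Y) (n : ℕ) (τ : Fin n → (Y ⟶ X))
    (hS : DeJong1996.SemiStablePair f g D τ) (x : X), IsClosed ({x} : Set X) →
      (∀ U : X.Opens, x ∈ U → ¬ Smooth (U.ι ≫ f)) →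
        ∀ (m r : ℕ) (t : Fin m → Y.presheaf.stalk (f x)),
          Ideal.span (Set.range t) = maximalIdeal (Y.presheaf.stalk (f x)) →
            ringKrullDim (Y.presheaf.stalk (f x)) = m → r ≤ m →
              stalkIdeal (vanishingIdeal ⟨D, hS.isStrictNormalCrossingsDivisor.isClosed⟩) (f x) =
                Ideal.span {∏ i ∈ Finset.univ.filter (fun i : Fin m => i.val < r), t i} →
                ∃ (ν : Fin m → ℕ) (e : AdicCompletion (maximalIdeal (X.presheaf.stalk x))
                    (X.presheaf.stalk x) ≃+* DeJong1996.FormalNodeRing k m ν),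
                  (∀ i : Fin m, r ≤ i.val → ν i = 0) ∧
                    (∀ i : Fin m, e (algebraMap _ _ ((f.stalkMap x).hom (t i))) =
                      Ideal.Quotient.mk _ (MvPowerSeries.X (Sum.inr i))) ∧
                    ((Scheme.Hom.singFittingIdeal f x).map (algebraMap (X.presheaf.stalk x)
                      (AdicCompletion (maximalIdeal (X.presheaf.stalk x))
                        (X.presheaf.stalk x)))).map e.toRingHom =
                      Ideal.span {Ideal.Quotient.mk _ (MvPowerSeries.X (Sum.inl 0)),
                        Ideal.Quotient.mk _ (MvPowerSeries.X (Sum.inl 1))}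

/-- The split nodal structure with the trace of `Sing(f)` refines the split nodal structure
(forget the Remark). [cite: DeJong1996, 2.23, pp. 61–62] -/
theorem DeJong1996SplitNodalStructure.of_sing (h : DeJong1996SplitNodalStructureSing.{u}) :
    DeJong1996SplitNodalStructure.{u} := by
  intro k _ _ X Y f g D n τ hS x hx hns m r t hspan hdim hrm hI
  obtain ⟨ν, e, hν, he, -⟩ := h k X Y f g D n τ hS x hx hns m r t hspan hdim hrm hI
  exact ⟨ν, e, hν, he⟩

/-! ## First consequences of the Remark -/

namespace DeJong1996.SemiStablePair

variable {k : Type u} [Field k] {X Y : Scheme.{u}} {f : X ⟶ Y} {g : Y ⟶ Spec (.of k)}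
  {D : Set Y} {n : ℕ} {τ : Fin n → (Y ⟶ X)}

/-- **A formal prime through the double locus is extended from the local ring, up to the
parameters it contains.** In the situation of `DeJong1996SplitNodalStructureSing`, a prime `Q`
of `𝒪̂_{X,x}` whose image under `e` contains the classes of `u` and `v` contains the extension
of the ideal `Fitt₁(Ω)_x` of `𝒪_{X,x}`; hence `Fitt₁(Ω)_x ⊆ Q ∩ 𝒪_{X,x}`. (This is how 3.4–3.5
read components of `Sing(X) ⊆ Sing(f)` on the completion.) [cite: DeJong1996, 2.23, p. 62] -/
theorem singFittingIdeal_le_comap {x : X} {m : ℕ} {ν : Fin m → ℕ}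
    (e : AdicCompletion (maximalIdeal (X.presheaf.stalk x)) (X.presheaf.stalk x) ≃+*
      DeJong1996.FormalNodeRing k m ν)
    (he : ((Scheme.Hom.singFittingIdeal f x).map (algebraMap (X.presheaf.stalk x)
      (AdicCompletion (maximalIdeal (X.presheaf.stalk x)) (X.presheaf.stalk x)))).map
        e.toRingHom =
      Ideal.span {Ideal.Quotient.mk _ (MvPowerSeries.X (Sum.inl 0)),
        Ideal.Quotient.mk _ (MvPowerSeries.X (Sum.inl 1))})
    (Q : Ideal (AdicCompletion (maximalIdeal (X.presheaf.stalk x)) (X.presheaf.stalk x)))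
    (hu : Ideal.Quotient.mk (Ideal.span {DeJong1996.formalNodeRelation k m ν})
      (MvPowerSeries.X (Sum.inl 0)) ∈ Q.map e.toRingHom)
    (hv : Ideal.Quotient.mk (Ideal.span {DeJong1996.formalNodeRelation k m ν})
      (MvPowerSeries.X (Sum.inl 1)) ∈ Q.map e.toRingHom) :
    Scheme.Hom.singFittingIdeal f x ≤ Q.comap (algebraMap (X.presheaf.stalk x)
      (AdicCompletion (maximalIdeal (X.presheaf.stalk x)) (X.presheaf.stalk x))) := by
  rw [← Ideal.map_le_iff_le_comap]
  -- `Fitt₁ · B̂ = e⁻¹ (u, v) ≤ e⁻¹ (e Q) = Q`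
  have h1 : ((Scheme.Hom.singFittingIdeal f x).map (algebraMap (X.presheaf.stalk x)
      (AdicCompletion (maximalIdeal (X.presheaf.stalk x)) (X.presheaf.stalk x)))).map
        e.toRingHom ≤ Q.map e.toRingHom := by
    rw [he, Ideal.span_le]
    rintro y (rfl | rfl)
    · exact hu
    · exact hv
  have h2 := Ideal.comap_mono (f := e.toRingHom) h1
  have hb : Function.Bijective e.toRingHom := e.bijective
  rwa [Ideal.comap_map_of_bijective e.toRingHom hb, Ideal.comap_map_of_bijective e.toRingHom hb]
    at h2

end DeJong1996.SemiStablePair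

end Literature.AlgebraicGeometry.Resolution

end
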